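import Literature.AlgebraicGeometry.Pohlmann1968.CMFamilyRankPartitionSlots
import Literature.AlgebraicGeometry.Pohlmann1968.CMFamilyRankSlots
import HarnessLib

/-!
# Nondegeneracy of a family of CM types from its fibres along ANY map, and the families on one or two indices

COR-CM (cell `pub-hodgecm2`, binder seat `b16` gen 43, count-neutral claim CM-DIMLE3-PRODUCTS, file D4a; theorems only, no
definition, no named fact, no `sorry`).  Plumbing for the census of products of simple CM abelian varieties of dimension
`≤ 3` (`CorCM/SimpleCMProductsDimLeThreeBlocks`, `…Hodge`), where a family is cut into blocks twice (Galois-closure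
classes, then isomorphism classes of fields) along maps `κ : I → C₀` into types WITHOUT a `Fintype` structure
(`IntermediateField ℚ ℂ`, `Finset I`):

* `isNondegenerateFamily_of_fibers` — for ANY `κ : I → C₀`: if no two slots with `κ i ≠ κ j` share a constituent and every
  NON-EMPTY fibre family `(Φ_i)_{κ i = c}` is nondegenerate, then `(Φ_i)_i` is nondegenerate (the criterion of
  `Pohlmann1968/CMFamilyRankPartitionSlots` along the corestriction of `κ` to its range, re-indexed by
  `cmFamilyRank_comp_equiv`);
* `isNondegenerateFamily_iff_of_equiv` — re-indexing a family along an equivalence of index types;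
* `isNondegenerateFamily_of_subsingleton` — a family on at most one index is nondegenerate iff (trivially: as soon as) its
  member is; `exists_pair_of_card_eq_two` — an index type of cardinality two is `{i₀, i₁}` with `i₀ ≠ i₁`.

HC_CM is NOT touched.

## References

* [Gordon1999HodgeAVSurvey] B. B. Gordon, *A survey of the Hodge conjecture for abelian varieties*, 7.4–7.7.
* [MoonenZarhin1999LowDim] B. Moonen, Yu. Zarhin, Math. Ann. 315 (1999), §3 (3.1).
-/

noncomputable section

open NumberField Module

namespace Summit.HodgeConjecture.CorCM

open Literature.NumberTheory.ComplexMultiplication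
open Literature.AlgebraicGeometry.Motives (CMType)
open Literature.AlgebraicGeometry.Pohlmann1968

variable {I : Type} {K : I → Type} [∀ i, Field (K i)] [∀ i, NumberField (K i)] [∀ i, IsCMField (K i)] [Fintype I]

/-! ## §1 Re-indexing along an equivalence -/

omit [∀ i, IsCMField (K i)] in
/-- **Nondegeneracy is invariant under re-indexing** the family along an equivalence `e : J ≃ I`.
[cite: Gordon1999HodgeAVSurvey, 7.6.1] -/
theorem isNondegenerateFamily_iff_of_equiv {J : Type} [Fintype J] (Φ : ∀ i, CMType (K i)) (e : J ≃ I) :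
    CMAlgebra.IsNondegenerateFamily (K := fun j => K (e j)) (fun j => Φ (e j)) ↔ CMAlgebra.IsNondegenerateFamily Φ := by
  rw [CMAlgebra.isNondegenerateFamily_iff, CMAlgebra.isNondegenerateFamily_iff, CMAlgebra.cmFamilyRank_comp_equiv Φ e,
    show (∑ j, finrank ℚ (K (e j))) = ∑ i, finrank ℚ (K i) from Fintype.sum_equiv e _ _ fun _ => rfl]

/-! ## §2 Nondegeneracy from the fibres of any map -/

/-- **Nondegeneracy from the fibres of ANY map `κ : I → C₀`.**  If no two slots `i, j` with `κ i ≠ κ j` share a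
constituent, and for every value `c` taken by `κ` the fibre family `(Φ_i)_{κ i = c}` is nondegenerate, then `(Φ_i)_i` is
nondegenerate. [cite: MoonenZarhin1999LowDim, §3 (3.1)] [cite: Gordon1999HodgeAVSurvey, §3 Theorem and 7.5] -/
theorem isNondegenerateFamily_of_fibers [Nonempty I] {C₀ : Type} [DecidableEq C₀] (Φ : ∀ i, CMType (K i))
    (κ : I → C₀)
    (hpair : ∀ i j, κ i ≠ κ j → ∀ P : Submodule ℚ ((K i →+* ℂ) → ℚ), P ≤ antiSpan (ℂ ≃+* ℂ) (Φ i).1 →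
      (∀ g : ℂ ≃+* ℂ, ∀ f ∈ P, (fun x => f (g • x)) ∈ P) →
      ∀ T : ((K i →+* ℂ) → ℚ) →ₗ[ℚ] ((K j →+* ℂ) → ℚ),
        (∀ g : ℂ ≃+* ℂ, ∀ f ∈ P, T (fun x => f (g • x)) = fun y => T f (g • y)) →
        (∀ f ∈ P, T f ∈ antiSpan (ℂ ≃+* ℂ) (Φ j).1) → (∀ f ∈ P, T f = 0 → f = 0) → P = ⊥)
    (hfib : ∀ c : C₀, (∃ i, κ i = c) →
      CMAlgebra.IsNondegenerateFamily (K := fun i : {i // κ i = c} => K i.1) fun i => Φ i.1) :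
    CMAlgebra.IsNondegenerateFamily Φ := by
  classical
  -- the corestriction of `κ` to its range
  let C : Type := {c : C₀ // ∃ i, κ i = c}
  haveI : Finite C := Finite.of_surjective (fun i : I => (⟨κ i, i, rfl⟩ : C)) fun c => by
    obtain ⟨c, i, rfl⟩ := c; exact ⟨i, rfl⟩
  letI : Fintype C := Fintype.ofFinite C
  let κ' : I → C := fun i => ⟨κ i, i, rfl⟩
  have hκ' : Function.Surjective κ' := fun c => by obtain ⟨c, i, rfl⟩ := c; exact ⟨i, rfl⟩
  refine (CMAlgebra.isNondegenerateFamily_iff_forall_fiber_of_pairwise_slots Φ κ' hκ'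
    (fun i j hij => hpair i j fun h => hij (Subtype.ext h))).2 fun c => ?_
  -- the fibre of `κ'` over `c` is the fibre of `κ` over `c.1`, re-indexed
  obtain ⟨c, i₀, hi₀⟩ := c
  let e : {i // κ i = c} ≃ {i // κ' i = ⟨c, i₀, hi₀⟩} :=
    Equiv.subtypeEquivRight fun i => by
      constructor
      · intro h; exact Subtype.ext h
      · intro h; exact congrArg Subtype.val h
  have h := hfib c ⟨i₀, hi₀⟩
  exact (isNondegenerateFamily_iff_of_equiv (K := fun i : {i // κ' i = ⟨c, i₀, hi₀⟩} => K i.1) (fun i => Φ i.1) e).1 h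

/-! ## §3 Families on at most one index, and on two -/

/-- **A family on a one-element index type is nondegenerate as soon as its member is.**
[cite: Gordon1999HodgeAVSurvey, 7.6.1] -/
theorem isNondegenerateFamily_of_subsingleton [Subsingleton I] [Nonempty I] (Φ : ∀ i, CMType (K i))
    (h : ∀ i, IsNondegenerate (Φ i)) : CMAlgebra.IsNondegenerateFamily Φ := by
  obtain ⟨i₀⟩ := ‹Nonempty I›
  letI : Unique I := ⟨⟨i₀⟩, fun j => Subsingleton.elim j i₀⟩
  exact (CMAlgebra.isNondegenerateFamily_iff_isNondegenerate Φ).2 (h default)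

omit [∀ i, Field (K i)] [∀ i, NumberField (K i)] [∀ i, IsCMField (K i)] in
/-- An index type of cardinality two consists of two distinct indices. [folklore] -/
theorem exists_pair_of_card_eq_two (h : Fintype.card I = 2) : ∃ i₀ i₁ : I, i₀ ≠ i₁ ∧ ∀ j, j = i₀ ∨ j = i₁ := by
  classical
  rw [← Finset.card_univ] at h
  obtain ⟨i₀, i₁, hne, huniv⟩ := Finset.card_eq_two.1 h
  refine ⟨i₀, i₁, hne, fun j => ?_⟩
  have : j ∈ ({i₀, i₁} : Finset I) := by rw [← huniv]; exact Finset.mem_univ j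
  simpa using this

omit [∀ i, Field (K i)] [∀ i, NumberField (K i)] [∀ i, IsCMField (K i)] in
/-- An index type of cardinality at most two is a subsingleton or a pair. [folklore] -/
theorem subsingleton_or_exists_pair_of_card_le_two (h : Fintype.card I ≤ 2) :
    Subsingleton I ∨ ∃ i₀ i₁ : I, i₀ ≠ i₁ ∧ ∀ j, j = i₀ ∨ j = i₁ := by
  by_cases h2 : Fintype.card I = 2
  · exact Or.inr (exists_pair_of_card_eq_two h2)
  · left
    exact Fintype.card_le_one_iff_subsingleton.1 (by omega)

end Summit.HodgeConjecture.CorCM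

end
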